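import Summits.NavierStokesRegularity.NavierStokesRegularity.Theorems.ExtremiserTransienceKStarAttainedEulerLagrange
import Summits.NavierStokesRegularity.NavierStokesRegularity.Theorems.ExtremiserTransienceKStarAttainedHalfSpaceVariation
import Literature.Analysis.FluidPDE.KNSSLiouvillePlanarHolds
import HarnessLib

/-!
# Route `ExtremiserTransience`, crux `RegularisedNearPlateauStability` (stmt-NavierStokesRegularity-28317),
# LINE g6-γ «bang-bang core», registered stub K2 `stub_densitySupBound`:
# THE EULER–LAGRANGE DENSITY IS BOUNDED BY `C_G(A)·M³·W·λ⁻³` IN THE A-REGULAR CLASS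

`--supports stmt-NavierStokesRegularity-28317` (serves the parent crux stmt-NavierStokesRegularity-26567 through
the skeleton `Cruxes/NearExtremalTransiencePerFlow/Lines/bangbang_core.lean`). Author: prover seat `ns-net-p2` (g0).

With `ω = curl v`, `J = ∫⟪ω, Dv ω⟫`, `Z = ‖ω‖₂²`, `W = ‖∇ω‖₂²`, `λ = √(Z/W)` and the landed explicit density
(`KStar.density_formula`, `KStar.continuous_density`)
`G = 2J·(curl curl (Dv ω) − curl (Dω ω) + curl curl (Dvᵀω)) − 2κ⋆²M²W·curl curl ω + 2κ⋆²M²Z·curl curl Δω`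
of the first variation `ℓ_v(curl η) = 2J·J₁(curl η) − 2κ⋆²M²(W·a₁(curl η) + Z·c₁(curl η)) = ∫⟪G, η⟫`:
for every budget `A` (`A_j ≥ 1`), with `C_G = 44‖curlCLM‖³(A₀+⋯+A₅)² + 1`, every admissible `v` (the route's
literal class) with `‖Dʲv‖ ≤ A_j·M·λ^{-j}` (all `j`) and `M√Z√W > 0` has `‖G(x)‖ ≤ C_G·M³·W·λ⁻³` for all `x`
(`BangBang.densitySupBound`). Ingredients: `‖Dⁿ curl w‖ ≤ ‖curlCLM‖‖Dⁿ⁺¹w‖`, `‖Dⁿ Δ w‖ ≤ 3‖Dⁿ⁺²w‖`,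
Leibniz bounds for `Dv[ω]`, `Dω[ω]`, `⟪ω, Dv eⱼ⟫` against geometric bounds `K·L^{i+a}` (binomial sum `2ⁿ`),
universality of `κ⋆` (`|J| ≤ κ⋆M√Z√W = κ⋆MλW`, `sharpDepletion_is_universal`), `Z = λ²W`, `κ⋆ < 1`.

`densitySupBound` is the registered stub with the skeleton's file-local abbreviations `IsAdm`, `IsReg`, `lam`,
`IsDensity`, `ell` unfolded one level (not importable from a `Cruxes/` file); the lead closes the stub by
`exact BangBang.densitySupBound` (definitional unfolding, checked). HONEST FRAMING: an elementary sup-norm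
estimate for an explicit differential expression; nothing about Navier–Stokes solutions, attainment of `κ⋆`, or
regularity is proved here; no summit is proved by a line. [folklore]
-/

noncomputable section

open Set Filter Topology MeasureTheory Metric
open scoped InnerProductSpace RealInnerProductSpace ENNReal NNReal ContDiff Laplacian
open Literature.Analysis.FluidPDE
open Summit.NavierStokesRegularity.NavierStokesRegularity.Theorems.DepletionLadder.KStar.HalfSpace

namespace Summit.NavierStokesRegularity.NavierStokesRegularity.Theorems

-- the problem directory repeats the summit name (`NavierStokesRegularity/NavierStokesRegularity`)
set_option linter.dupNamespace false

namespace DepletionLadder.KStar.BangBang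

variable {w v : E3 → E3}
/-- `‖curl w (x)‖ ≤ ‖curlCLM‖ ‖Dw(x)‖` in iterated-derivative form. [folklore] -/
theorem norm_curl_le_D1 (hw : ContDiff ℝ ∞ w) (x : E3) :
    ‖curl w x‖ ≤ ‖curlCLM‖ * ‖iteratedFDeriv ℝ 1 w x‖ := by
  have h := norm_iteratedFDeriv_curl_le_opNorm_mul (N := ⊤) hw 0 le_top x
  rwa [norm_iteratedFDeriv_zero] at h

/-- `‖Dⁿ(curl w)(x)‖ ≤ ‖curlCLM‖ ‖Dⁿ⁺¹w(x)‖`. [folklore] -/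
theorem norm_D_curl_le (hw : ContDiff ℝ ∞ w) (n : ℕ) (x : E3) :
    ‖iteratedFDeriv ℝ n (curl w) x‖ ≤ ‖curlCLM‖ * ‖iteratedFDeriv ℝ (n + 1) w x‖ :=
  norm_iteratedFDeriv_curl_le_opNorm_mul (N := ⊤) hw n le_top x

/-- `‖curl curl w (x)‖ ≤ ‖curlCLM‖² ‖D²w(x)‖`. [folklore] -/
theorem norm_curl_curl_le_D2 (hw : ContDiff ℝ ∞ w) (x : E3) :
    ‖curl (curl w) x‖ ≤ ‖curlCLM‖ ^ 2 * ‖iteratedFDeriv ℝ 2 w x‖ := by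
  have hcw : ContDiff ℝ ∞ (curl w) := contDiff_curl_top hw
  calc ‖curl (curl w) x‖ ≤ ‖curlCLM‖ * ‖iteratedFDeriv ℝ 1 (curl w) x‖ :=
        norm_curl_le_D1 hcw x
    _ ≤ ‖curlCLM‖ * (‖curlCLM‖ *
          ‖iteratedFDeriv ℝ 2 w x‖) := by gcongr; exact norm_D_curl_le hw 1 x
    _ = _ := by ring

/-- `‖curl curl curl w (x)‖ ≤ ‖curlCLM‖³ ‖D³w(x)‖`. [folklore] -/
theorem norm_curl3_le_D3 (hw : ContDiff ℝ ∞ w) (x : E3) :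
    ‖curl (curl (curl w)) x‖ ≤ ‖curlCLM‖ ^ 3 * ‖iteratedFDeriv ℝ 3 w x‖ := by
  have hcw : ContDiff ℝ ∞ (curl w) := contDiff_curl_top hw
  calc ‖curl (curl (curl w)) x‖ ≤ ‖curlCLM‖ ^ 2 * ‖iteratedFDeriv ℝ 2 (curl w) x‖ :=
        norm_curl_curl_le_D2 hcw x
    _ ≤ ‖curlCLM‖ ^ 2 * (‖curlCLM‖ *
          ‖iteratedFDeriv ℝ 3 w x‖) := by gcongr; exact norm_D_curl_le hw 2 x
    _ = _ := by ring

/-- `‖curl curl Δ (curl v) (x)‖ ≤ 3‖curlCLM‖³ ‖D⁵v(x)‖`. [folklore] -/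
theorem norm_curl_curl_laplacian_curl_le (hv : ContDiff ℝ ∞ v) (x : E3) :
    ‖curl (curl (Δ (curl v))) x‖ ≤ 3 * ‖curlCLM‖ ^ 3 * ‖iteratedFDeriv ℝ 5 v x‖ := by
  have hω : ContDiff ℝ ∞ (curl v) := contDiff_curl_top hv
  have hΔ : ContDiff ℝ ∞ (Δ (curl v)) := contDiff_laplacian (n := ⊤) (by exact_mod_cast hω)
  have h3 : (Module.finrank ℝ E3 : ℝ) = 3 := by simp
  calc ‖curl (curl (Δ (curl v))) x‖
      ≤ ‖curlCLM‖ ^ 2 * ‖iteratedFDeriv ℝ 2 (Δ (curl v)) x‖ := norm_curl_curl_le_D2 hΔ x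
    _ ≤ ‖curlCLM‖ ^ 2 * (3 * ‖iteratedFDeriv ℝ 4 (curl v) x‖) := by
        gcongr
        have h := norm_iteratedFDeriv_laplacian_le hω 2 x
        rwa [h3] at h
    _ ≤ ‖curlCLM‖ ^ 2 * (3 * (‖curlCLM‖ *
          ‖iteratedFDeriv ℝ 5 v x‖)) := by gcongr; exact norm_D_curl_le hv 4 x
    _ = _ := by ring

/-- The binomial sum against geometric bounds: if `uᵢ ≤ P·L^{i+a}` and `wᵢ ≤ Q·L^{i+b}` for `i ≤ n` then
`Σᵢ C(n,i) uᵢ w_{n−i} ≤ 2ⁿ · P Q L^{n+a+b}`. [folklore] -/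
theorem sum_choose_mul_le {n a b : ℕ} {u w : ℕ → ℝ} {P Q L : ℝ} (hu0 : ∀ i, 0 ≤ u i) (hw0 : ∀ i, 0 ≤ w i)
    (hu : ∀ i, i ≤ n → u i ≤ P * L ^ (i + a)) (hw : ∀ i, i ≤ n → w i ≤ Q * L ^ (i + b)) :
    ∑ i ∈ Finset.range (n + 1), (n.choose i : ℝ) * u i * w (n - i) ≤ 2 ^ n * (P * Q * L ^ (n + a + b)) := by
  have hterm : ∀ i ∈ Finset.range (n + 1),
      (n.choose i : ℝ) * u i * w (n - i) ≤ (n.choose i : ℝ) * (P * Q * L ^ (n + a + b)) := by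
    intro i hi
    have hin : i ≤ n := Nat.lt_succ_iff.mp (Finset.mem_range.mp hi)
    have h1 := hu i hin
    have h2 := hw (n - i) (Nat.sub_le n i)
    have hP' : 0 ≤ P * L ^ (i + a) := (hu0 i).trans h1
    have hprod : u i * w (n - i) ≤ (P * L ^ (i + a)) * (Q * L ^ (n - i + b)) := mul_le_mul h1 h2 (hw0 _) hP'
    have hexp : (P * L ^ (i + a)) * (Q * L ^ (n - i + b)) = P * Q * L ^ (n + a + b) := by
      have : i + a + (n - i + b) = n + a + b := by omega
      rw [← this, pow_add]; ring
    rw [mul_assoc]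
    exact mul_le_mul_of_nonneg_left (hprod.trans_eq hexp) (Nat.cast_nonneg _)
  calc ∑ i ∈ Finset.range (n + 1), (n.choose i : ℝ) * u i * w (n - i)
      ≤ ∑ i ∈ Finset.range (n + 1), (n.choose i : ℝ) * (P * Q * L ^ (n + a + b)) := Finset.sum_le_sum hterm
    _ = (∑ i ∈ Finset.range (n + 1), (n.choose i : ℝ)) * (P * Q * L ^ (n + a + b)) := by rw [Finset.sum_mul]
    _ = 2 ^ n * (P * Q * L ^ (n + a + b)) := by
        congr 1
        exact_mod_cast Nat.sum_range_choose n

/-- Leibniz bound for `y ↦ f(y)[g(y)]` against geometric derivative bounds. [folklore] -/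
theorem norm_iteratedFDeriv_clm_apply_le_pow {f : E3 → E3 →L[ℝ] E3} {g : E3 → E3} (hf : ContDiff ℝ ∞ f)
    (hg : ContDiff ℝ ∞ g) (x : E3) {n a b : ℕ} {P Q L : ℝ}
    (hfb : ∀ i, i ≤ n → ‖iteratedFDeriv ℝ i f x‖ ≤ P * L ^ (i + a))
    (hgb : ∀ i, i ≤ n → ‖iteratedFDeriv ℝ i g x‖ ≤ Q * L ^ (i + b)) :
    ‖iteratedFDeriv ℝ n (fun y => f y (g y)) x‖ ≤ 2 ^ n * (P * Q * L ^ (n + a + b)) :=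
  (norm_iteratedFDeriv_clm_apply (n := n) hf hg x (by exact_mod_cast le_top)).trans
    (sum_choose_mul_le (fun _ => norm_nonneg _) (fun _ => norm_nonneg _) hfb hgb)

/-- Leibniz bound for `y ↦ ⟪f(y), g(y)⟫` against geometric derivative bounds. [folklore] -/
theorem norm_iteratedFDeriv_inner_le_pow {f g : E3 → E3} (hf : ContDiff ℝ ∞ f) (hg : ContDiff ℝ ∞ g) (x : E3)
    {n a b : ℕ} {P Q L : ℝ}
    (hfb : ∀ i, i ≤ n → ‖iteratedFDeriv ℝ i f x‖ ≤ P * L ^ (i + a))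
    (hgb : ∀ i, i ≤ n → ‖iteratedFDeriv ℝ i g x‖ ≤ Q * L ^ (i + b)) :
    ‖iteratedFDeriv ℝ n (fun y => ⟪f y, g y⟫_ℝ) x‖ ≤ 2 ^ n * (P * Q * L ^ (n + a + b)) := by
  have hB : ‖(innerSL ℝ : E3 →L[ℝ] E3 →L[ℝ] ℝ)‖ ≤ 1 := norm_innerSL_le ℝ
  have h := (innerSL ℝ : E3 →L[ℝ] E3 →L[ℝ] ℝ).norm_iteratedFDeriv_le_of_bilinear_of_le_one (n := n) hf hg x
    (by exact_mod_cast le_top) hB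
  exact h.trans (sum_choose_mul_le (fun _ => norm_nonneg _) (fun _ => norm_nonneg _) hfb hgb)

/-- `‖Dⁿ(y ↦ φ(y) • e)(x)‖ ≤ ‖e‖ ‖Dⁿφ(x)‖`. [folklore] -/
theorem norm_iteratedFDeriv_smul_const_le {φ : E3 → ℝ} (hφ : ContDiff ℝ ∞ φ) (e : E3) (n : ℕ) (x : E3) :
    ‖iteratedFDeriv ℝ n (fun y => φ y • e) x‖ ≤ ‖e‖ * ‖iteratedFDeriv ℝ n φ x‖ := by
  rw [iteratedFDeriv_smul_const_apply (hφ.contDiffAt.of_le (by exact_mod_cast le_top))]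
  refine (ContinuousLinearMap.norm_compContinuousMultilinearMap_le _ _).trans ?_
  gcongr
  rw [ContinuousLinearMap.norm_smulRight_apply]
  calc ‖ContinuousLinearMap.id ℝ ℝ‖ * ‖e‖ ≤ 1 * ‖e‖ := by gcongr; exact ContinuousLinearMap.norm_id_le
    _ = ‖e‖ := one_mul _

/-! ## The five pieces of the explicit density against a geometric derivative budget `‖Dʲv(x)‖ ≤ K·Lʲ` (`j ≤ 5`) -/

section Pieces

variable (hv : ContDiff ℝ ∞ v) {K L : ℝ} {x : E3} (hK : ∀ j, j ≤ 5 → ‖iteratedFDeriv ℝ j v x‖ ≤ K * L ^ j)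
include hv hK

/-- `‖curl curl (Dv ω)(x)‖ ≤ 4‖curlCLM‖³ K² L⁴`. [folklore] -/
theorem norm_piece₁_le : ‖curl (curl (fun y => fderiv ℝ v y (curl v y))) x‖ ≤ 4 * ‖curlCLM‖ ^ 3 * K ^ 2 * L ^ 4 := by
  have hc0 : 0 ≤ ‖curlCLM‖ := norm_nonneg curlCLM
  have hω : ContDiff ℝ ∞ (curl v) := contDiff_curl_top hv
  have hDv : ContDiff ℝ ∞ (fderiv ℝ v) := hv.fderiv_right (m := ∞) le_rfl
  have hs₁ : ContDiff ℝ ∞ (fun y => fderiv ℝ v y (curl v y)) := hDv.clm_apply hω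
  have bDv : ∀ i, i ≤ 2 → ‖iteratedFDeriv ℝ i (fderiv ℝ v) x‖ ≤ K * L ^ (i + 1) := fun i hi => by
    rw [norm_iteratedFDeriv_fderiv]; exact hK (i + 1) (by omega)
  have bω : ∀ i, i ≤ 2 → ‖iteratedFDeriv ℝ i (curl v) x‖ ≤ ‖curlCLM‖ * K * L ^ (i + 1) := fun i hi =>
    (norm_D_curl_le hv i x).trans (by rw [mul_assoc]; exact mul_le_mul_of_nonneg_left (hK (i + 1) (by omega)) hc0)
  have h := norm_iteratedFDeriv_clm_apply_le_pow hDv hω x (n := 2) bDv bω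
  calc _ ≤ ‖curlCLM‖ ^ 2 * ‖iteratedFDeriv ℝ 2 (fun y => fderiv ℝ v y (curl v y)) x‖ := norm_curl_curl_le_D2 hs₁ x
    _ ≤ ‖curlCLM‖ ^ 2 * (2 ^ 2 * (K * (‖curlCLM‖ * K) * L ^ (2 + 1 + 1))) :=
        mul_le_mul_of_nonneg_left h (pow_nonneg hc0 2)
    _ = 4 * ‖curlCLM‖ ^ 3 * K ^ 2 * L ^ 4 := by ring

/-- `‖curl (Dω ω)(x)‖ ≤ 2‖curlCLM‖³ K² L⁴`. [folklore] -/
theorem norm_piece₂_le : ‖curl (fun y => fderiv ℝ (curl v) y (curl v y)) x‖ ≤ 2 * ‖curlCLM‖ ^ 3 * K ^ 2 * L ^ 4 := by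
  have hc0 : 0 ≤ ‖curlCLM‖ := norm_nonneg curlCLM
  have hω : ContDiff ℝ ∞ (curl v) := contDiff_curl_top hv
  have hDω : ContDiff ℝ ∞ (fderiv ℝ (curl v)) := hω.fderiv_right (m := ∞) le_rfl
  have hs₂ : ContDiff ℝ ∞ (fun y => fderiv ℝ (curl v) y (curl v y)) := hDω.clm_apply hω
  have bω : ∀ i, i ≤ 1 → ‖iteratedFDeriv ℝ i (curl v) x‖ ≤ ‖curlCLM‖ * K * L ^ (i + 1) := fun i hi =>
    (norm_D_curl_le hv i x).trans (by rw [mul_assoc]; exact mul_le_mul_of_nonneg_left (hK (i + 1) (by omega)) hc0)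
  have bDω : ∀ i, i ≤ 1 → ‖iteratedFDeriv ℝ i (fderiv ℝ (curl v)) x‖ ≤ ‖curlCLM‖ * K * L ^ (i + 2) :=
    fun i hi => by
      rw [norm_iteratedFDeriv_fderiv]
      exact (norm_D_curl_le hv (i + 1) x).trans (by
        rw [mul_assoc]; exact mul_le_mul_of_nonneg_left (hK (i + 2) (by omega)) hc0)
  have h := norm_iteratedFDeriv_clm_apply_le_pow hDω hω x (n := 1) bDω bω
  calc _ ≤ ‖curlCLM‖ * ‖iteratedFDeriv ℝ 1 (fun y => fderiv ℝ (curl v) y (curl v y)) x‖ := norm_curl_le_D1 hs₂ x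
    _ ≤ ‖curlCLM‖ * (2 ^ 1 * (‖curlCLM‖ * K * (‖curlCLM‖ * K) * L ^ (1 + 2 + 1))) :=
        mul_le_mul_of_nonneg_left h hc0
    _ = 2 * ‖curlCLM‖ ^ 3 * K ^ 2 * L ^ 4 := by ring

/-- `‖curl curl (Dvᵀω)(x)‖ ≤ 12‖curlCLM‖³ K² L⁴` (`Dvᵀω = Σⱼ ⟪ω, Dv eⱼ⟫ eⱼ`). [folklore] -/
theorem norm_piece₃_le : ‖curl (curl (fun y => ∑ j, ⟪curl v y, fderiv ℝ v y (EuclideanSpace.basisFun (Fin 3) ℝ j)⟫_ℝ •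
        EuclideanSpace.basisFun (Fin 3) ℝ j)) x‖ ≤ 12 * ‖curlCLM‖ ^ 3 * K ^ 2 * L ^ 4 := by
  have hc0 : 0 ≤ ‖curlCLM‖ := norm_nonneg curlCLM
  have hω : ContDiff ℝ ∞ (curl v) := contDiff_curl_top hv
  have hDv : ContDiff ℝ ∞ (fderiv ℝ v) := hv.fderiv_right (m := ∞) le_rfl
  have hg : ∀ j, ContDiff ℝ ∞ (fun y => fderiv ℝ v y (EuclideanSpace.basisFun (Fin 3) ℝ j)) := fun j =>
    hDv.clm_apply contDiff_const
  have hφ : ∀ j, ContDiff ℝ ∞ (fun y => ⟪curl v y, fderiv ℝ v y (EuclideanSpace.basisFun (Fin 3) ℝ j)⟫_ℝ) :=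
    fun j => hω.inner ℝ (hg j)
  have hF : ∀ j, ContDiff ℝ ∞ (fun y => ⟪curl v y, fderiv ℝ v y (EuclideanSpace.basisFun (Fin 3) ℝ j)⟫_ℝ •
      EuclideanSpace.basisFun (Fin 3) ℝ j) := fun j => (hφ j).smul contDiff_const
  have hF2 : ∀ j, ContDiff ℝ 2 (fun y => ⟪curl v y, fderiv ℝ v y (EuclideanSpace.basisFun (Fin 3) ℝ j)⟫_ℝ •
      EuclideanSpace.basisFun (Fin 3) ℝ j) := fun j => (hF j).of_le (by norm_cast)
  have hs₃ : ContDiff ℝ ∞ (fun y => ∑ j, ⟪curl v y, fderiv ℝ v y (EuclideanSpace.basisFun (Fin 3) ℝ j)⟫_ℝ •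
        EuclideanSpace.basisFun (Fin 3) ℝ j) := ContDiff.sum fun j _ => hF j
  have bω : ∀ i, i ≤ 2 → ‖iteratedFDeriv ℝ i (curl v) x‖ ≤ ‖curlCLM‖ * K * L ^ (i + 1) := fun i hi =>
    (norm_D_curl_le hv i x).trans (by rw [mul_assoc]; exact mul_le_mul_of_nonneg_left (hK (i + 1) (by omega)) hc0)
  have bg : ∀ j : Fin 3, ∀ i, i ≤ 2 →
      ‖iteratedFDeriv ℝ i (fun y => fderiv ℝ v y (EuclideanSpace.basisFun (Fin 3) ℝ j)) x‖ ≤ K * L ^ (i + 1) :=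
    fun j i hi => by
      have h := norm_iteratedFDeriv_clm_apply_const (f := fderiv ℝ v) (c := EuclideanSpace.basisFun (Fin 3) ℝ j)
        (n := i) (hDv.contDiffAt (x := x)) (by exact_mod_cast le_top)
      rw [(EuclideanSpace.basisFun (Fin 3) ℝ).orthonormal.1 j, one_mul, norm_iteratedFDeriv_fderiv] at h
      exact h.trans (hK (i + 1) (by omega))
  have hterm : ∀ j : Fin 3,
      ‖iteratedFDeriv ℝ 2 (fun y => ⟪curl v y, fderiv ℝ v y (EuclideanSpace.basisFun (Fin 3) ℝ j)⟫_ℝ •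
        EuclideanSpace.basisFun (Fin 3) ℝ j) x‖ ≤ 2 ^ 2 * (‖curlCLM‖ * K * K * L ^ (2 + 1 + 1)) := fun j => by
    calc _ ≤ ‖EuclideanSpace.basisFun (Fin 3) ℝ j‖ *
          ‖iteratedFDeriv ℝ 2 (fun y => ⟪curl v y, fderiv ℝ v y (EuclideanSpace.basisFun (Fin 3) ℝ j)⟫_ℝ) x‖ :=
          norm_iteratedFDeriv_smul_const_le (hφ j) _ 2 x
      _ = ‖iteratedFDeriv ℝ 2 (fun y => ⟪curl v y, fderiv ℝ v y (EuclideanSpace.basisFun (Fin 3) ℝ j)⟫_ℝ) x‖ := by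
          rw [(EuclideanSpace.basisFun (Fin 3) ℝ).orthonormal.1 j, one_mul]
      _ ≤ _ := norm_iteratedFDeriv_inner_le_pow hω (hg j) x (n := 2) bω (bg j)
  have hD2 : ‖iteratedFDeriv ℝ 2 (fun y => ∑ j, ⟪curl v y, fderiv ℝ v y (EuclideanSpace.basisFun (Fin 3) ℝ j)⟫_ℝ •
        EuclideanSpace.basisFun (Fin 3) ℝ j) x‖ ≤ 3 * (2 ^ 2 * (‖curlCLM‖ * K * K * L ^ (2 + 1 + 1))) := by
    rw [iteratedFDeriv_fun_sum_apply (f := fun (j : Fin 3) (y : E3) =>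
      ⟪curl v y, fderiv ℝ v y (EuclideanSpace.basisFun (Fin 3) ℝ j)⟫_ℝ • EuclideanSpace.basisFun (Fin 3) ℝ j)
      (fun j _ => (hF2 j).contDiffAt)]
    calc ‖∑ j, iteratedFDeriv ℝ 2 (fun y => ⟪curl v y, fderiv ℝ v y (EuclideanSpace.basisFun (Fin 3) ℝ j)⟫_ℝ •
          EuclideanSpace.basisFun (Fin 3) ℝ j) x‖
        ≤ ∑ j, ‖iteratedFDeriv ℝ 2 (fun y => ⟪curl v y, fderiv ℝ v y (EuclideanSpace.basisFun (Fin 3) ℝ j)⟫_ℝ •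
          EuclideanSpace.basisFun (Fin 3) ℝ j) x‖ := norm_sum_le _ _
      _ ≤ ∑ _j : Fin 3, 2 ^ 2 * (‖curlCLM‖ * K * K * L ^ (2 + 1 + 1)) := Finset.sum_le_sum fun j _ => hterm j
      _ = 3 * (2 ^ 2 * (‖curlCLM‖ * K * K * L ^ (2 + 1 + 1))) := by
          simp only [Finset.sum_const, Finset.card_univ, Fintype.card_fin, nsmul_eq_mul, Nat.cast_ofNat]
  calc _ ≤ ‖curlCLM‖ ^ 2 * ‖iteratedFDeriv ℝ 2 (fun y => ∑ j, ⟪curl v y, fderiv ℝ v y (EuclideanSpace.basisFun (Fin 3) ℝ j)⟫_ℝ •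
          EuclideanSpace.basisFun (Fin 3) ℝ j) x‖ := norm_curl_curl_le_D2 hs₃ x
    _ ≤ ‖curlCLM‖ ^ 2 * (3 * (2 ^ 2 * (‖curlCLM‖ * K * K * L ^ (2 + 1 + 1)))) :=
        mul_le_mul_of_nonneg_left hD2 (pow_nonneg hc0 2)
    _ = 12 * ‖curlCLM‖ ^ 3 * K ^ 2 * L ^ 4 := by ring

/-- `‖curl curl curl v(x)‖ ≤ ‖curlCLM‖³ K L³`. [folklore] -/
theorem norm_piece₄_le : ‖curl (curl (curl v)) x‖ ≤ ‖curlCLM‖ ^ 3 * (K * L ^ 3) :=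
  (norm_curl3_le_D3 hv x).trans
    (mul_le_mul_of_nonneg_left (hK 3 (by norm_num)) (pow_nonneg (norm_nonneg curlCLM) 3))

/-- `‖curl curl Δω(x)‖ ≤ 3‖curlCLM‖³ K L⁵`. [folklore] -/
theorem norm_piece₅_le : ‖curl (curl (Δ (curl v))) x‖ ≤ 3 * ‖curlCLM‖ ^ 3 * (K * L ^ 5) :=
  (norm_curl_curl_laplacian_curl_le hv x).trans (mul_le_mul_of_nonneg_left (hK 5 le_rfl) (by positivity))

end Pieces

/-- Pointwise bound for the explicit Euler–Lagrange density of `KStar.density_formula` (coefficients `2J`,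
`−2κ⋆²M²W`, `−2κ⋆²M²Z`) under the uniform budget `‖Dʲv(x)‖ ≤ S·M·Lʲ` (`j ≤ 5`), `|J| ≤ κ⋆MλW`, `Z = λ²W`, `λL = 1`:
`‖G(x)‖ ≤ (44‖curlCLM‖³S² + 1)·M³·W·L³`. [folklore] -/
theorem norm_density_le (hv : ContDiff ℝ ∞ v) {S M L lam : ℝ} (hS1 : 1 ≤ S) (hM : 0 ≤ M) (hL : 0 ≤ L)
    (hW0 : 0 ≤ Wpa v) {x : E3} (hK : ∀ j, j ≤ 5 → ‖iteratedFDeriv ℝ j v x‖ ≤ S * M * L ^ j)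
    (hJ : |Jst v| ≤ kStar * M * lam * Wpa v) (hZ : Zen v = lam ^ 2 * Wpa v) (hlamL : lam * L = 1) :
    ‖(2 * Jst v) • (curl (curl (fun y => fderiv ℝ v y (curl v y))) x - curl (fun y => fderiv ℝ (curl v) y (curl v y)) x +
          curl (curl (fun y => ∑ j, ⟪curl v y, fderiv ℝ v y (EuclideanSpace.basisFun (Fin 3) ℝ j)⟫_ℝ •
            EuclideanSpace.basisFun (Fin 3) ℝ j)) x) +
        (-(2 * kStar ^ 2 * M ^ 2 * Wpa v)) • curl (curl (curl v)) x -
        (-(2 * kStar ^ 2 * M ^ 2 * Zen v)) • curl (curl (Δ (curl v))) x‖ ≤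
      (44 * ‖curlCLM‖ ^ 3 * S ^ 2 + 1) * M ^ 3 * Wpa v * L ^ 3 := by
  set c : ℝ := ‖curlCLM‖
  set g₁ : E3 := curl (curl (fun y => fderiv ℝ v y (curl v y))) x
  set g₂ : E3 := curl (fun y => fderiv ℝ (curl v) y (curl v y)) x
  set g₃ : E3 := curl (curl (fun y => ∑ j, ⟪curl v y, fderiv ℝ v y (EuclideanSpace.basisFun (Fin 3) ℝ j)⟫_ℝ •
        EuclideanSpace.basisFun (Fin 3) ℝ j)) x
  set g₄ : E3 := curl (curl (curl v)) x
  set g₅ : E3 := curl (curl (Δ (curl v))) x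
  have hc0 : 0 ≤ c := norm_nonneg curlCLM
  have hS0 : 0 ≤ S := zero_le_one.trans hS1
  have hk0 : 0 ≤ kStar := kStar_pos.le
  have hk1 : kStar ≤ 1 := sharpDepletion_lt_one.le
  have hZ0 : 0 ≤ Zen v := by rw [hZ]; positivity
  have T1 : ‖g₁‖ ≤ 4 * c ^ 3 * (S * M) ^ 2 * L ^ 4 := norm_piece₁_le hv hK
  have T2 : ‖g₂‖ ≤ 2 * c ^ 3 * (S * M) ^ 2 * L ^ 4 := norm_piece₂_le hv hK
  have T3 : ‖g₃‖ ≤ 12 * c ^ 3 * (S * M) ^ 2 * L ^ 4 := norm_piece₃_le hv hK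
  have T4 : ‖g₄‖ ≤ c ^ 3 * (S * M * L ^ 3) := norm_piece₄_le hv hK
  have T5 : ‖g₅‖ ≤ 3 * c ^ 3 * (S * M * L ^ 5) := norm_piece₅_le hv hK
  have ha0 : 0 ≤ 2 * kStar ^ 2 * M ^ 2 * Wpa v := by positivity
  have hb0 : 0 ≤ 2 * kStar ^ 2 * M ^ 2 * Zen v := by positivity
  have hsum : ‖g₁‖ + ‖g₂‖ + ‖g₃‖ ≤ 18 * c ^ 3 * (S * M) ^ 2 * L ^ 4 := by linarith only [T1, T2, T3]
  have hY : 0 ≤ c ^ 3 * M ^ 3 * Wpa v * L ^ 3 := by positivity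
  have hX : 0 ≤ M ^ 3 * Wpa v * L ^ 3 := by positivity
  have hJM : 0 ≤ kStar * M * lam * Wpa v := (abs_nonneg _).trans hJ
  have h44 : 36 * kStar * S ^ 2 + 8 * kStar ^ 2 * S ≤ 44 * S ^ 2 := by
    have hk2 : kStar ^ 2 ≤ 1 := by nlinarith only [hk0, hk1]
    have hSS : S ≤ S ^ 2 := by nlinarith only [hS1]
    nlinarith only [hk0, hk1, hk2, hS0, hSS, sq_nonneg S]
  calc ‖(2 * Jst v) • (g₁ - g₂ + g₃) + (-(2 * kStar ^ 2 * M ^ 2 * Wpa v)) • g₄ -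
        (-(2 * kStar ^ 2 * M ^ 2 * Zen v)) • g₅‖
      ≤ ‖(2 * Jst v) • (g₁ - g₂ + g₃) + (-(2 * kStar ^ 2 * M ^ 2 * Wpa v)) • g₄‖ +
        ‖(-(2 * kStar ^ 2 * M ^ 2 * Zen v)) • g₅‖ := norm_sub_le _ _
    _ ≤ ‖(2 * Jst v) • (g₁ - g₂ + g₃)‖ + ‖(-(2 * kStar ^ 2 * M ^ 2 * Wpa v)) • g₄‖ +
        ‖(-(2 * kStar ^ 2 * M ^ 2 * Zen v)) • g₅‖ := by gcongr; exact norm_add_le _ _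
    _ = 2 * |Jst v| * ‖g₁ - g₂ + g₃‖ + 2 * kStar ^ 2 * M ^ 2 * Wpa v * ‖g₄‖ +
        2 * kStar ^ 2 * M ^ 2 * Zen v * ‖g₅‖ := by
        rw [norm_smul, norm_smul, norm_smul, Real.norm_eq_abs, Real.norm_eq_abs, Real.norm_eq_abs, abs_neg, abs_neg,
          abs_of_nonneg ha0, abs_of_nonneg hb0, abs_mul, abs_two]
    _ ≤ 2 * |Jst v| * (‖g₁‖ + ‖g₂‖ + ‖g₃‖) + 2 * kStar ^ 2 * M ^ 2 * Wpa v * ‖g₄‖ +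
        2 * kStar ^ 2 * M ^ 2 * Zen v * ‖g₅‖ := by
        gcongr
        exact (norm_add_le _ _).trans (by gcongr; exact norm_sub_le _ _)
    _ ≤ 2 * (kStar * M * lam * Wpa v) * (18 * c ^ 3 * (S * M) ^ 2 * L ^ 4) +
        2 * kStar ^ 2 * M ^ 2 * Wpa v * (c ^ 3 * (S * M * L ^ 3)) +
        2 * kStar ^ 2 * M ^ 2 * Zen v * (3 * c ^ 3 * (S * M * L ^ 5)) := by gcongr
    _ = (36 * kStar * S ^ 2 * (lam * L) + 2 * kStar ^ 2 * S + 6 * kStar ^ 2 * S * (lam * L) ^ 2) *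
        (c ^ 3 * M ^ 3 * Wpa v * L ^ 3) := by rw [hZ]; ring
    _ = (36 * kStar * S ^ 2 + 8 * kStar ^ 2 * S) * (c ^ 3 * M ^ 3 * Wpa v * L ^ 3) := by rw [hlamL]; ring
    _ ≤ 44 * S ^ 2 * (c ^ 3 * M ^ 3 * Wpa v * L ^ 3) := mul_le_mul_of_nonneg_right h44 hY
    _ = 44 * c ^ 3 * S ^ 2 * (M ^ 3 * Wpa v * L ^ 3) := by ring
    _ ≤ (44 * c ^ 3 * S ^ 2 + 1) * (M ^ 3 * Wpa v * L ^ 3) := mul_le_mul_of_nonneg_right (by linarith) hX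
    _ = (44 * c ^ 3 * S ^ 2 + 1) * M ^ 3 * Wpa v * L ^ 3 := by ring

/-- **K2 — DENSITY SUP BOUND** (registered stub `stub_densitySupBound` of LINE `bangbang_core`, vocabulary unfolded):
for every budget `A ≥ 1` there is `C_G > 0` such that every admissible, `A`-regular (`‖Dʲv‖ ≤ A_j M λ^{-j}`, `λ = √(Z/W)`),
non-degenerate (`M√Z√W > 0`) field `v` admits a continuous Euler–Lagrange density `G` of the first variation
`ℓ_v(curl η) = 2J·J₁ − 2κ⋆²M²(W·a₁ + Z·c₁)` with `‖G(x)‖ ≤ C_G·M³·W·λ⁻³` everywhere (explicit density of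
`KStar.density_formula`; `C_G = 44‖curlCLM‖³(Σ_{j<6}A_j)² + 1`). [folklore] -/
theorem densitySupBound :
    ∀ A : ℕ → ℝ, (∀ j, 1 ≤ A j) → ∃ C_G : ℝ, 0 < C_G ∧ ∀ (v : E3 → E3) (M B : ℝ),
      (ContDiff ℝ (⊤ : ℕ∞) v ∧ VectorCalculus.IsDivFree v ∧ (∀ x, ‖v x‖ ≤ M) ∧ (∀ x, ‖fderiv ℝ v x‖ ≤ B) ∧
        (∫⁻ x, ‖iteratedFDeriv ℝ 0 v x‖ₑ ^ 2 < ⊤) ∧ (∫⁻ x, ‖iteratedFDeriv ℝ 1 v x‖ₑ ^ 2 < ⊤) ∧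
        (∫⁻ x, ‖iteratedFDeriv ℝ 2 v x‖ₑ ^ 2 < ⊤)) →
      (∀ (j : ℕ) (x : E3), ‖iteratedFDeriv ℝ j v x‖ ≤ A j * M * (Real.sqrt (Zen v / Wpa v))⁻¹ ^ j) →
      0 < M * Real.sqrt (Zen v) * Real.sqrt (Wpa v) →
        ∃ G : E3 → E3, (Continuous G ∧ ∀ η : E3 → E3, ContDiff ℝ ∞ η → HasCompactSupport η →
          2 * Jst v * J1 v (curl η) - 2 * kStar ^ 2 * M ^ 2 * (Wpa v * A1 v (curl η) + Zen v * C1 v (curl η)) =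
            ∫ x, ⟪G x, η x⟫_ℝ) ∧
          ∀ x, ‖G x‖ ≤ C_G * M ^ 3 * Wpa v * (Real.sqrt (Zen v / Wpa v))⁻¹ ^ 3 := by
  intro A hA
  have hA0 : ∀ j, 0 ≤ A j := fun j => zero_le_one.trans (hA j)
  have hAS : ∀ j, j ≤ 5 → A j ≤ ∑ k ∈ Finset.range 6, A k := fun j hj =>
    Finset.single_le_sum (f := A) (fun k _ => hA0 k) (Finset.mem_range.2 (by omega))
  have hS1 : 1 ≤ ∑ k ∈ Finset.range 6, A k := (hA 0).trans (hAS 0 (by norm_num))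
  set S : ℝ := ∑ k ∈ Finset.range 6, A k
  have hc0 : 0 ≤ ‖curlCLM‖ := norm_nonneg curlCLM
  refine ⟨44 * ‖curlCLM‖ ^ 3 * S ^ 2 + 1, by positivity, ?_⟩
  rintro v M B ⟨hv, hdiv, hM, hB, h0, h1, h2⟩ hreg hpos
  -- non-degeneracy: `M, Z, W, λ > 0`
  have hZ0 : 0 ≤ Zen v := integral_nonneg fun x => by positivity
  have hW0 : 0 ≤ Wpa v := integral_nonneg fun x => frobeniusNormSq_nonneg _
  have hMpos : 0 < M := by
    by_contra h
    exact absurd hpos (not_lt.2 (mul_nonpos_of_nonpos_of_nonneg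
      (mul_nonpos_of_nonpos_of_nonneg (not_lt.1 h) (Real.sqrt_nonneg _)) (Real.sqrt_nonneg _)))
  have hsZpos : 0 < Real.sqrt (Zen v) :=
    lt_of_le_of_ne (Real.sqrt_nonneg _) fun h => by rw [← h] at hpos; simp at hpos
  have hsWpos : 0 < Real.sqrt (Wpa v) :=
    lt_of_le_of_ne (Real.sqrt_nonneg _) fun h => by rw [← h] at hpos; simp at hpos
  have hZpos : 0 < Zen v := Real.sqrt_pos.1 hsZpos
  have hWpos : 0 < Wpa v := Real.sqrt_pos.1 hsWpos
  set lam : ℝ := Real.sqrt (Zen v / Wpa v) with hlamdef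
  have hlampos : 0 < lam := Real.sqrt_pos.2 (div_pos hZpos hWpos)
  set L : ℝ := lam⁻¹
  have hLpos : 0 < L := inv_pos.2 hlampos
  have hlamL : lam * L = 1 := mul_inv_cancel₀ hlampos.ne'
  have hlam_sqW : lam * Real.sqrt (Wpa v) = Real.sqrt (Zen v) := by
    rw [hlamdef, ← Real.sqrt_mul (div_nonneg hZ0 hW0), div_mul_cancel₀ _ hWpos.ne']
  have hsZsW : Real.sqrt (Zen v) * Real.sqrt (Wpa v) = lam * Wpa v := by
    rw [← hlam_sqW, mul_assoc, Real.mul_self_sqrt hW0]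
  have hZeq : Zen v = lam ^ 2 * Wpa v := by
    have h := Real.sq_sqrt (div_nonneg hZ0 hW0)
    rw [← hlamdef] at h
    rw [h, div_mul_cancel₀ _ hWpos.ne']
  -- universality of `κ⋆`: `|J| ≤ κ⋆ M √Z √W = κ⋆ M λ W`
  have hJ : |Jst v| ≤ kStar * M * Real.sqrt (Zen v) * Real.sqrt (Wpa v) :=
    sharpDepletion_is_universal v M B hv hdiv hM hB h0 h1 h2
  have hJ' : |Jst v| ≤ kStar * M * lam * Wpa v := by
    calc |Jst v| ≤ kStar * M * (Real.sqrt (Zen v) * Real.sqrt (Wpa v)) := by rw [← mul_assoc]; exact hJ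
      _ = kStar * M * lam * Wpa v := by rw [hsZsW]; ring
  -- the regularity budget, uniformised: `‖Dʲv‖ ≤ S·M·Lʲ` for `j ≤ 5`
  have hK : ∀ x, ∀ j, j ≤ 5 → ‖iteratedFDeriv ℝ j v x‖ ≤ S * M * L ^ j := fun x j hj =>
    (hreg j x).trans (mul_le_mul_of_nonneg_right (mul_le_mul_of_nonneg_right (hAS j hj) hMpos.le)
      (pow_nonneg hLpos.le j))
  -- the density of `KStar.density_formula` / `KStar.continuous_density`
  refine ⟨fun x => ((2 * Jst v) • (curl (curl (fun y => fderiv ℝ v y (curl v y))) x -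
      curl (fun y => fderiv ℝ (curl v) y (curl v y)) x +
      curl (curl (fun y => ∑ j, ⟪curl v y, fderiv ℝ v y (EuclideanSpace.basisFun (Fin 3) ℝ j)⟫_ℝ •
        EuclideanSpace.basisFun (Fin 3) ℝ j)) x) +
      (-(2 * kStar ^ 2 * M ^ 2 * Wpa v)) • curl (curl (curl v)) x -
      (-(2 * kStar ^ 2 * M ^ 2 * Zen v)) • curl (curl (Δ (curl v))) x), ⟨?_, ?_⟩, ?_⟩
  · exact continuous_density hv (2 * Jst v) (-(2 * kStar ^ 2 * M ^ 2 * Wpa v)) (-(2 * kStar ^ 2 * M ^ 2 * Zen v))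
  · intro η hη hηc
    refine Eq.trans ?_ (density_formula hv (2 * Jst v) (-(2 * kStar ^ 2 * M ^ 2 * Wpa v))
      (-(2 * kStar ^ 2 * M ^ 2 * Zen v)) hη hηc)
    simp only [J1, A1, C1]
    ring
  · intro x
    exact norm_density_le hv hS1 hMpos.le hLpos.le hW0 (hK x) hJ' hZeq hlamL

end DepletionLadder.KStar.BangBang

end Summit.NavierStokesRegularity.NavierStokesRegularity.Theorems

end
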